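import Summits.BirchSwinnertonDyer.BirchSwinnertonDyer.Theorems.ManinLocalTwoThreeTwoAdicDegeneracyUnitTwistLemmas
import Summits.BirchSwinnertonDyer.Rank1Residual.ManinAdditive.KatoCurvePlusDefectLevers
import Summits.BirchSwinnertonDyer.Rank1Residual.ManinAdditive.TowerUnitTwist
import HarnessLib

/-!
# THEOREM U at `p = 2`, part 2/2: the ODD-order character with `χ(8) ≠ 1` and a `2`-adic unit twisted value from the ratio-`8`
# degeneracy plus index; E-es-66₂ on the SQUAREFULL locus ⟸ E-es-68₈; `2 ∤ c(W)` there modulo Kato's F♯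

Summit `BirchSwinnertonDyer`, route `ManinLocalTwoThree` (cell bsd-f2-manin), crux C2 `ManinOddAtFour` (stmt-BirchSwinnertonDyer-22967).
The `p = 2` twin of `…DegeneracyUnitTwist` / `…DegeneracyUnitTwistSquarefull`.  At `p = 2` Fourier inversion mod `2` over all of
`(ℤ/m)ˣ` is void; the repair (part 1, `…TwoAdicDegeneracyUnitTwistLemmas`) is the EVEN relative span lemma at primes `m ≡ 3 (mod 4)`,
where `(m − 1)/2` is odd and every even character has ODD order (`DirichletCharacter.orderOf_dvd_div_two_of_even`).

* `exists_prime_character_two_unit_twist_of_degeneracyPlusIndex` — rational newform `f` on `Γ₀(N)`, `4 ∣ N`, `t ≥ 1`, every `x ∈ Λ_f`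
  has an ODD multiple of `x + x̄` among the plus parts of `closure (degeneracyLoops f t)` ⟹ a prime `m ∤ tN`, `m ≡ 3 (mod 4)`, an EVEN
  `χ` mod `m` with `χ(t̄) ≠ 1`, `S_χ = r·Ω⁺_f`, `s·r/2` never an algebraic integer (`s` odd).
* `tamePolarTwoUnitTwistOfDegeneracyEightPlusIndex` — t = 8: `(m, 2N) = 1`, primitive, `χ ≠ 1`, ODD order, `χ(8) ≠ 1` = the allowed
  set of the tree's `TwoAdicPolarWitness` / F♯.
* `twoAdicPolarWitness_of_degeneracyEightPlusIndex` — a datum `D` of `W` at a SQUAREFULL level `4 ∣ N` (additivity at `2` from the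
  tree's `KatoCurve.additive_of_sq_dvd_level`, no modularity binder) whose newform has odd ratio-`8` degeneracy plus index carries a
  `TwoAdicPolarWitness W W D.f`; `twoAdicPolarWitness_of_degeneracyLoopLawEight` — **E-es-66₂ `TwoAdicWitnessOfPlusIndexOdd` on the
  squarefull locus ⟸ E-es-68₈ `DegeneracyLoopLawEight`** (the existing ratio-`8` lattice law), a second parent of the C2 input h66₂
  beside an's E-an-136₂ (`TowerUnitTwist 2`).
* `not_two_dvd_maninConstant_of_degeneracyLoopLawEight_squarefull` (+ `_irreducible` from F♯ `kato_neron_isIntegral_twistedSymbolSum_of_additive_two_real`,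
  + law-free `…_of_degeneracyEightPlusIndex_squarefull`) — **`2 ∤ D.c`** at composite squarefull `4 ∣ N` (an odd prime `q` with `q² ∣ N`
  discharges `PlusIndexPrimeTo 2`), modulo `KatoFactTwoAt W D.f` (+ E-es-68₈).

HONEST FRAMING: CONDITIONAL reductions (E-es-68₈ typed `@[conjecture]`; F♯ a Literature `def`); the f-level core is unconditional.
C2, Manin's conjecture and BSD are NOT proved by this.  No definitions, no named facts, no sorry.
-/

set_option linter.dupNamespace false
set_option autoImplicit false

noncomputable section

open scoped Classical MatrixGroups ModularForm ComplexConjugate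

open CongruenceSubgroup Complex Literature.NumberTheory.EllipticCurves
  Literature.NumberTheory.EllipticCurves.ModularForms
  Summit.BirchSwinnertonDyer.Rank1Residual.ManinAdditive.Gamma1Lattice
  Summit.BirchSwinnertonDyer.Rank1Residual.ManinAdditive.KatoCurve

namespace Summit.BirchSwinnertonDyer.BirchSwinnertonDyer.Theorems.ManinLocalTwoThree

variable {N : ℕ} [NeZero N] {f : CuspForm (Gamma0 N) 2}

/-! ### §1 The f-level core at `p = 2` -/

/-- **THEOREM U at `p = 2`, f-level core.**  `f` a rational newform on `Γ₀(N)`, `4 ∣ N`, `t ≥ 1`, and every `x ∈ Λ_f` has an ODD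
multiple of `x + x̄` among the plus parts of `closure (degeneracyLoops f t)` ⟹ a prime `m ∤ tN`, `m ≡ 3 (mod 4)`, an even `χ` mod `m`
with `χ(t) ≠ 1`, and `S_χ = r·Ω⁺_f` with `s·r/2` not an algebraic integer for every odd `s`. -/
theorem exists_prime_character_two_unit_twist_of_degeneracyPlusIndex (hf : IsNewform0 f) (hQ : coeffField f = ⊥)
    (h4 : 4 ∣ N) {t : ℕ} (ht : 0 < t)
    (hd : ∀ x ∈ periodLattice f, ∃ y ∈ AddSubgroup.closure (degeneracyLoops f t), ∃ k : ℕ, ¬ 2 ∣ k ∧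
      (k : ℂ) * (x + conj x) = y + conj y) :
    ∃ (m : ℕ) (_ : Fact m.Prime) (χ : DirichletCharacter ℂ m) (r : ℂ), ¬ m ∣ t * N ∧ m % 4 = 3 ∧
      χ (t : ZMod m) ≠ 1 ∧ χ.Even ∧ twistedSymbolSum f χ = r * (plusPeriod f : ℂ) ∧
      ∀ s : ℕ, ¬ 2 ∣ s → ¬ IsIntegral ℤ ((s : ℂ) * r / 2) := by
  obtain ⟨hpos, -⟩ := plusPeriod_pos_and_realPeriods_eq isZLattice_periodLattice_holds hf hQ
  have hΩ : (plusPeriod f : ℂ) ≠ 0 := by exact_mod_cast hpos.ne'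
  have hreal : ∀ n, (cuspCoeff f n).im = 0 := cuspCoeff_im_eq_zero_of_coeffField_eq_bot hQ
  -- a loop with ODD plus part
  have hS : degeneracyLoops f t ⊆ periodLattice f := fun z hz ↦
    periodLatticeGamma1_le_periodLattice f (closure_degeneracyLoops_le f t (AddSubgroup.subset_closure hz))
  obtain ⟨z, ⟨ℓ, b, hℓp, hℓt, hℓb, rfl⟩, j, hj, hj2⟩ := exists_mem_plus_not_dvd hf hQ (p := 2) hS hd
  -- the sign move: `m ≡ 3 (mod 4)`
  obtain ⟨m, hmp, hmt, hmb, hm4, hplus⟩ := exists_degeneracyLoop_prime_mod_four_eq_three f hreal h4 ht hℓp hℓt hℓb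
  rw [← hplus] at hj
  haveI : Fact m.Prime := ⟨hmp⟩
  have hmN : ¬ m ∣ N := fun h ↦ hmt (h.mul_left t)
  have hmt' : ¬ m ∣ t := fun h ↦ hmt (h.mul_right N)
  have hNm : IsCoprime (N : ℤ) m :=
    (Nat.isCoprime_iff_coprime.mpr ((Nat.Prime.coprime_iff_not_dvd hmp).mpr hmN)).symm
  -- the integer-valued even function `F`
  have hF : ∀ a : ZMod m, ∃ k : ℤ, (modularSymbol f ((a.val : ℚ) / m) - modularSymbol f 0) +
      conj (modularSymbol f ((a.val : ℚ) / m) - modularSymbol f 0) = (k : ℂ) * (plusPeriod f : ℂ) :=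
    fun a ↦ exists_int_add_conj_eq_mul_plusPeriod hf hQ (cuspDiff_mem_periodLattice f hNm a)
  choose F hF using hF
  have hFeven : ∀ a : ZMod m, F (-a) = F a := by
    intro a
    have h1 := hF (-a)
    rw [cuspDiff_neg_val_eq_conj f hreal, Complex.conj_conj, add_comm, hF a] at h1
    exact_mod_cast (mul_right_cancel₀ hΩ h1).symm
  -- `F (t̄ b̄) − F b̄ = j` is odd
  have htb : ((t * b : ℕ) : ZMod m) = (t : ZMod m) * (b : ZMod m) := by push_cast; rfl
  have hzF : (j : ℂ) * (plusPeriod f : ℂ) =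
      ((F ((t : ZMod m) * (b : ZMod m)) - F (b : ZMod m) : ℤ) : ℂ) * (plusPeriod f : ℂ) := by
    rw [← hj, modularSymbol_natCast_div_eq_val f (t * b), modularSymbol_natCast_div_eq_val f b, htb]
    have e : modularSymbol f (((((t : ZMod m) * (b : ZMod m))).val : ℚ) / m) -
        modularSymbol f ((((b : ZMod m)).val : ℚ) / m) =
        (modularSymbol f (((((t : ZMod m) * (b : ZMod m))).val : ℚ) / m) - modularSymbol f 0) -
          (modularSymbol f ((((b : ZMod m)).val : ℚ) / m) - modularSymbol f 0) := by ring
    rw [e, map_sub, Int.cast_sub, sub_mul, ← hF, ← hF]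
    ring
  have hjF : j = F ((t : ZMod m) * (b : ZMod m)) - F (b : ZMod m) := by
    have := mul_right_cancel₀ hΩ hzF
    exact_mod_cast this
  have hunit_t : IsUnit ((t : ℕ) : ZMod m) :=
    (ZMod.isUnit_iff_coprime t m).mpr ((Nat.Prime.coprime_iff_not_dvd hmp).mpr hmt').symm
  have hunit_b : IsUnit ((b : ℕ) : ZMod m) :=
    (ZMod.isUnit_iff_coprime b m).mpr ((Nat.Prime.coprime_iff_not_dvd hmp).mpr hmb).symm
  -- `φ(m) = 2 · (m / 2)` with `m / 2` odd
  have hφ : m.totient = 2 * (m / 2) := by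
    rw [Nat.totient_prime hmp]
    omega
  have hpn : ¬ 2 ∣ m / 2 := by omega
  -- the EVEN relative span lemma at `p = 2`, contrapositively
  have hex : ∃ χ : DirichletCharacter ℂ m, χ.Even ∧ χ (t : ZMod m) ≠ 1 ∧
      ∀ s : ℕ, ¬ 2 ∣ s → ¬ IsIntegral ℤ ((s : ℂ) * (∑ a : ZMod m, χ a * (F a : ℂ)) / (2 * ((2 : ℕ) : ℂ))) := by
    by_contra hcon
    push Not at hcon
    have := Int.dvd_sub_of_forall_even_isIntegral_charSum_div Nat.prime_two hφ hpn F hFeven hunit_t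
      (fun χ hev hχ ↦ hcon χ hev hχ) hunit_b
    exact hj2 (hjF ▸ (by exact_mod_cast this))
  obtain ⟨χ, hev, hχt, hχ⟩ := hex
  have hχ1 : χ ≠ 1 := by
    rintro rfl
    exact hχt (MulChar.one_apply hunit_t)
  -- half-sum identity, `r = F̂(χ)/2`
  refine ⟨m, ⟨hmp⟩, χ, (∑ a : ZMod m, χ a * (F a : ℂ)) / 2, hmt, hm4, hχt, hev, ?_, ?_⟩
  · have h2 := two_mul_twistedSymbolSum_eq_sum_plus f hreal hχ1 hev
    simp_rw [hF, ← mul_assoc, ← Finset.sum_mul] at h2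
    have : twistedSymbolSum f χ = (∑ a : ZMod m, χ a * (F a : ℂ)) * (plusPeriod f : ℂ) / 2 := by
      rw [← h2]; ring
    rw [this]; ring
  · intro s hs hI
    refine hχ s hs ?_
    have e : ((s : ℂ) * (∑ a : ZMod m, χ a * (F a : ℂ)) / (2 * ((2 : ℕ) : ℂ))) =
        (s : ℂ) * ((∑ a : ZMod m, χ a * (F a : ℂ)) / 2) / 2 := by push_cast; ring
    rw [e]
    exact hI

/-! ### §2 The packaged f-level law, t = 8 -/

/-- **E-es-66₂'s twisted-value half from the ratio-`8` degeneracy index (f-level)**: `4 ∣ N`, rational newform, odd ratio-`8`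
degeneracy plus index ⟹ a primitive `χ ≠ 1` of prime conductor `m`, `(m, 2N) = 1`, ODD order, `χ(8) ≠ 1`, `S_χ = r·Ω⁺_f`, `s·r/2`
never an algebraic integer for odd `s`. -/
theorem tamePolarTwoUnitTwistOfDegeneracyEightPlusIndex (hf : IsNewform0 f) (hQ : coeffField f = ⊥) (h4 : 4 ∣ N)
    (hd : ∀ x ∈ periodLattice f, ∃ y ∈ AddSubgroup.closure (degeneracyLoops f 8), ∃ k : ℕ, ¬ 2 ∣ k ∧
      (k : ℂ) * (x + conj x) = y + conj y) :
    ∃ (m : ℕ) (_ : NeZero m) (χ : DirichletCharacter ℂ m) (r : ℂ),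
      m.Coprime (2 * N) ∧ χ.IsPrimitive ∧ χ ≠ 1 ∧ ¬ 2 ∣ orderOf χ ∧ χ (8 : ZMod m) ≠ 1 ∧ χ.Even ∧
      twistedSymbolSum f χ = r * (plusPeriod f : ℂ) ∧
      ∀ s : ℕ, ¬ 2 ∣ s → ¬ IsIntegral ℤ ((s : ℂ) * r / 2) := by
  obtain ⟨m, hm, χ, r, hmt, hm4, hχt, hev, hr, hu⟩ :=
    exists_prime_character_two_unit_twist_of_degeneracyPlusIndex hf hQ h4 (t := 8) (by norm_num) hd
  have hmp : m.Prime := hm.out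
  haveI : NeZero m := ⟨hmp.ne_zero⟩
  have hχ1 : χ ≠ 1 := by
    rintro rfl
    exact hχt (MulChar.one_apply ((ZMod.isUnit_iff_coprime 8 m).mpr
      ((Nat.Prime.coprime_iff_not_dvd hmp).mpr fun h ↦ hmt (h.mul_right N)).symm))
  have h8 : χ (8 : ZMod m) ≠ 1 := by exact_mod_cast hχt
  have hodd : ¬ 2 ∣ orderOf χ := by
    intro h
    have := dvd_trans h (DirichletCharacter.orderOf_dvd_div_two_of_even hev)
    omega
  refine ⟨m, inferInstance, χ, r, ?_, DirichletCharacter.isPrimitive_of_prime hχ1, hχ1, hodd, h8, hev, hr, hu⟩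
  refine (Nat.Prime.coprime_iff_not_dvd hmp).mpr fun h ↦ hmt ?_
  exact dvd_trans h (mul_dvd_mul_right (by norm_num) N)

/-! ### §3 W-level at SQUAREFULL level `4 ∣ N` -/

/-- **The `2`-adic polar witness from the ratio-`8` degeneracy index** (squarefull `4 ∣ N`; `W` additive at `2` by the tree's
`KatoCurve.additive_of_sq_dvd_level`; ρ = 1; empty Euler product). -/
theorem twoAdicPolarWitness_of_degeneracyEightPlusIndex
    (W : WeierstrassCurve ℚ) [W.IsElliptic] {N : ℕ} [NeZero N] (D : ModularParametrizationData W N)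
    (h4 : 2 ^ 2 ∣ N) (hsq : ∀ ℓ ∈ N.primeFactors, ℓ ^ 2 ∣ N)
    (hd : ∀ x ∈ periodLattice D.f, ∃ y ∈ AddSubgroup.closure (degeneracyLoops D.f 8), ∃ k : ℕ, ¬ 2 ∣ k ∧
      (k : ℂ) * (x + conj x) = y + conj y) :
    TwoAdicPolarWitness W W D.f := by
  have h4' : 4 ∣ N := by simpa using h4
  have hadd := additive_of_sq_dvd_level 2 W D.f D.isNewformOf h4
  obtain ⟨m, hm, χ, r, hcop, hprim, hχ1, hodd, h8, -, hr, hu⟩ :=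
    tamePolarTwoUnitTwistOfDegeneracyEightPlusIndex D.isNewformOf.1 D.isNewformOf.coeffField_eq_bot h4' hd
  have hempty : (N.primeFactors.filter fun ℓ ↦ ¬ ℓ ^ 2 ∣ N) = ∅ :=
    Finset.filter_eq_empty_iff.mpr fun ℓ hℓ h ↦ h (hsq ℓ hℓ)
  refine ⟨m, hm, χ, r, 1, D.isNewformOf, hadd.1, hadd.2, hcop, hprim, hχ1, hodd, h8, by simp, ?_, ?_⟩
  · rw [hempty, Finset.prod_empty, one_mul, hr]
  · intro s hs
    have : (s : ℂ) * r * ((1 : ℚ) : ℂ) / 2 = (s : ℂ) * r / 2 := by push_cast; ring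
    rw [this]
    exact hu s hs

/-- **E-es-66₂ on the SQUAREFULL locus ⟸ E-es-68₈**: the ratio-`8` degeneracy-loop law makes `closure (degeneracyLoops f 8) = Λ₁(f)`,
so `PlusIndexPrimeTo 2 D.f` is the odd ratio-`8` degeneracy index. -/
theorem twoAdicPolarWitness_of_degeneracyLoopLawEight (h68 : DegeneracyLoopLawEight)
    (W : WeierstrassCurve ℚ) [W.IsElliptic] {N : ℕ} [NeZero N] (D : ModularParametrizationData W N)
    (h4 : 2 ^ 2 ∣ N) (hsq : ∀ ℓ ∈ N.primeFactors, ℓ ^ 2 ∣ N) (hpi : PlusIndexPrimeTo 2 D.f) :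
    TwoAdicPolarWitness W W D.f := by
  refine twoAdicPolarWitness_of_degeneracyEightPlusIndex W D h4 hsq fun x hx ↦ ?_
  obtain ⟨y, hy, k, hk, hxy⟩ := hpi x hx
  exact ⟨y, by rw [h68 h4 D.f]; exact hy, k, hk, hxy⟩

/-- **`2 ∤ c(W)` at COMPOSITE SQUAREFULL level `4 ∣ N` modulo `KatoFactTwoAt W D.f` and E-es-68₈**: an odd prime `q` with `q² ∣ N`
discharges `PlusIndexPrimeTo 2` (Hecke sieve `plusIndexPrimeTo_of_sq_dvd`). CONDITIONAL. [cite: Kato2004Asterisque, Thm. 12.5 (1) (p. 221)] -/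
theorem not_two_dvd_maninConstant_of_degeneracyLoopLawEight_squarefull (h68 : DegeneracyLoopLawEight)
    (W : WeierstrassCurve ℚ) [W.IsElliptic] [W.IsGloballyMinimal] {N : ℕ} [NeZero N]
    (D : ModularParametrizationData W N) (hF : KatoFactTwoAt W D.f)
    (hopt : ∀ z ∈ D.L.lattice, ∃ w ∈ periodLattice D.f, z = D.c * w)
    (h4 : 2 ^ 2 ∣ N) (hsq : ∀ ℓ ∈ N.primeFactors, ℓ ^ 2 ∣ N)
    {q : ℕ} (hq : q.Prime) (hq2 : q ≠ 2) (hqN : q ^ 2 ∣ N) : ¬ (2 : ℤ) ∣ D.c := by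
  have hpq : ¬ 2 ∣ q := fun h ↦ hq2 ((Nat.prime_dvd_prime_iff_eq Nat.prime_two hq).mp h).symm
  have hwit : TwoAdicPolarWitness W W D.f :=
    twoAdicPolarWitness_of_degeneracyLoopLawEight h68 W D h4 hsq (plusIndexPrimeTo_of_sq_dvd D.isNewformOf.1 hq hqN hpq)
  have hΩ : W.realPeriodRat = ((|D.c| : ℤ) : ℝ) * plusPeriod D.f := by
    rw [Int.cast_abs]; exact D.realPeriodRat_eq_abs_mul_plusPeriod_of_latticeEq hopt
  have hc0 : D.c ≠ 0 := D.maninConstant_ne_zero_holds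
  have h := not_two_dvd_of_katoFactTwoAt_of_witness W W D.f |D.c| hF hwit hΩ (abs_ne_zero.mpr hc0)
  exact fun h2 ↦ h ((dvd_abs 2 D.c).mpr h2)

/-- **The same from F♯ on the `W[2]`-IRREDUCIBLE locus** (`katoFactTwoAt_of_real`). CONDITIONAL on F♯ + E-es-68₈.
[cite: Kato2004Asterisque, Thm. 12.5 (1) (p. 221)] -/
theorem not_two_dvd_maninConstant_of_degeneracyLoopLawEight_squarefull_irreducible (h68 : DegeneracyLoopLawEight)
    (hK : kato_neron_isIntegral_twistedSymbolSum_of_additive_two_real)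
    (W : WeierstrassCurve ℚ) [W.IsElliptic] [W.IsGloballyMinimal] {N : ℕ} [NeZero N]
    (D : ModularParametrizationData W N) (hirr : W.HasIrreducibleModPGaloisRep 2)
    (hopt : ∀ z ∈ D.L.lattice, ∃ w ∈ periodLattice D.f, z = D.c * w)
    (h4 : 2 ^ 2 ∣ N) (hsq : ∀ ℓ ∈ N.primeFactors, ℓ ^ 2 ∣ N)
    {q : ℕ} (hq : q.Prime) (hq2 : q ≠ 2) (hqN : q ^ 2 ∣ N) : ¬ (2 : ℤ) ∣ D.c :=
  not_two_dvd_maninConstant_of_degeneracyLoopLawEight_squarefull h68 W D (katoFactTwoAt_of_real hK W D.f hirr) hopt h4 hsq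
    hq hq2 hqN

/-- **Law-free form**: the f-SPECIFIC odd ratio-`8` degeneracy index of `D.f` in place of E-es-68₈. CONDITIONAL on Kato's fact at `W`.
[cite: Kato2004Asterisque, Thm. 12.5 (1) (p. 221)] -/
theorem not_two_dvd_maninConstant_of_degeneracyEightPlusIndex_squarefull
    (W : WeierstrassCurve ℚ) [W.IsElliptic] [W.IsGloballyMinimal] {N : ℕ} [NeZero N]
    (D : ModularParametrizationData W N) (hF : KatoFactTwoAt W D.f)
    (hopt : ∀ z ∈ D.L.lattice, ∃ w ∈ periodLattice D.f, z = D.c * w)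
    (h4 : 2 ^ 2 ∣ N) (hsq : ∀ ℓ ∈ N.primeFactors, ℓ ^ 2 ∣ N)
    (hd : ∀ x ∈ periodLattice D.f, ∃ y ∈ AddSubgroup.closure (degeneracyLoops D.f 8), ∃ k : ℕ, ¬ 2 ∣ k ∧
      (k : ℂ) * (x + conj x) = y + conj y) : ¬ (2 : ℤ) ∣ D.c := by
  have hwit : TwoAdicPolarWitness W W D.f := twoAdicPolarWitness_of_degeneracyEightPlusIndex W D h4 hsq hd
  have hΩ : W.realPeriodRat = ((|D.c| : ℤ) : ℝ) * plusPeriod D.f := by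
    rw [Int.cast_abs]; exact D.realPeriodRat_eq_abs_mul_plusPeriod_of_latticeEq hopt
  have hc0 : D.c ≠ 0 := D.maninConstant_ne_zero_holds
  have h := not_two_dvd_of_katoFactTwoAt_of_witness W W D.f |D.c| hF hwit hΩ (abs_ne_zero.mpr hc0)
  exact fun h2 ↦ h ((dvd_abs 2 D.c).mpr h2)

end Summit.BirchSwinnertonDyer.BirchSwinnertonDyer.Theorems.ManinLocalTwoThree

end
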